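import Mathlib
import HarnessLib

/-!
# `TeissierResolve`, line Sketch — stub `stub_chartAssembly` (étale chart assembly)

Crux `stmt-ResolutionOfSingularities-17086`
(`Summit.ResolutionOfSingularities.ResolutionOfSingularities.Theses.TeissierJung.TeissierResolve`),
line "toric normalisation + destackification". This file proves the plumbing stub
`stub_chartAssembly` of the lead skeleton.

## Informal statement

Let `k` be a field, `g : X → Spec k` locally of finite type and quasi-compact, `x ∈ X`. Let `S` be
a smooth finitely generated `k`-algebra graded by a finite abelian group `A`, `T = Spec S₀` the
spectrum of its degree-`0` part, `t ∈ T`, and `e : 𝒪̂_{X,x} ≃ 𝒪̂_{T,t}` a ring isomorphism of the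
completed local rings compatible with the two `k`-structures. Assume

* (`hA`, Artin 1969 Cor. 2.6, taken as a hypothesis) `k`-compatible isomorphic completed local
  rings give a common étale neighbourhood `X ← X'' → T` over `k` through a point over `x` and `t`;
* (`hFT`, hypothesis) the degree-`0` part of a finitely generated `k`-algebra graded by a finite
  abelian group is finitely generated;
* (`hBC`, hypothesis) every étale `S₀`-algebra `R` is `k`-isomorphic to the degree-`0` part of a
  smooth finitely generated `A`-graded `k`-algebra `S'`.

Then there is a smooth finitely generated `k`-algebra `S'` graded by a finite abelian group with an
étale `k`-morphism `φ : Spec S'₀ → X` whose image contains `x` (a Bergh–Rydh chart at `x`).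

## Proof sketch

Artin (`hA`) applied to `g` and `T → Spec k` gives étale `e₁ : X'' → X`, `e₂ : X'' → T` over `k`
and `x'' ∈ X''` over `x`. Choose an affine open `U ∋ x''` of `X''` and put `R = Γ(X'', U)`. The
composite `Spec R = U ↪ X'' → T = Spec S₀` is étale and of the form `Spec σ` for a ring map
`σ : S₀ → R`, so `R` is an étale `S₀`-algebra; `hBC` gives `S'` and `ψ : S'₀ ≃ₐ[k] R`. The chart is
`φ = Spec ψ⁻¹ ≫ (Spec R ↪ X'') ≫ e₁`: étale as a composite of an isomorphism, an open immersion and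
an étale map; its image contains `e₁ x'' = x`; and it lies over `k` because `e₁ ≫ g = e₂ ≫ (T → k)`
and `ψ` is a `k`-algebra map.

Sources: standard scheme-theoretic plumbing (Mathlib's `AlgebraicGeometry` API); the mathematical
inputs (Artin approximation, graded base change) enter only as hypotheses. [folklore]
-/

noncomputable section

set_option linter.dupNamespace false -- mandated namespace of this single-conjunct summit

open CategoryTheory AlgebraicGeometry TopologicalSpace IsLocalRing

namespace Summit.ResolutionOfSingularities.ResolutionOfSingularities.Theorems.TeissierResolve.ChartAssembly

/-- **Étale chart assembly.** From a `k`-compatible isomorphism of completed local rings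
`𝒪̂_{X,x} ≃ 𝒪̂_{Spec S₀,t}` (`S` smooth, finitely generated, graded by a finite abelian group),
Artin's common-étale-neighbourhood theorem (`hA`), finite generation of degree-`0` parts (`hFT`)
and étale base change of graded algebras (`hBC`), one gets an étale `k`-morphism
`Spec S'₀ → X` through `x` with `S'` smooth finitely generated graded by a finite abelian group.
[folklore] -/
theorem stub_chartAssembly
    (hA : ∀ (k : Type) [Field k] (X₁ X₂ : Scheme.{0}) (f₁ : X₁ ⟶ Spec (.of k))
      (f₂ : X₂ ⟶ Spec (.of k)),
      LocallyOfFiniteType f₁ → QuasiCompact f₁ → LocallyOfFiniteType f₂ → QuasiCompact f₂ →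
      ∀ (x₁ : X₁) (x₂ : X₂)
        (e : AdicCompletion (maximalIdeal (X₁.presheaf.stalk x₁)) (X₁.presheaf.stalk x₁) ≃+*
          AdicCompletion (maximalIdeal (X₂.presheaf.stalk x₂)) (X₂.presheaf.stalk x₂)),
        (∀ a : k,
          e (algebraMap _ _ ((X₁.presheaf.germ ⊤ x₁ trivial).hom
              (f₁.appTop.hom ((Scheme.ΓSpecIso (.of k)).inv.hom a)))) =
            algebraMap _ _ ((X₂.presheaf.germ ⊤ x₂ trivial).hom
              (f₂.appTop.hom ((Scheme.ΓSpecIso (.of k)).inv.hom a)))) →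
        ∃ (X' : Scheme.{0}) (e₁ : X' ⟶ X₁) (e₂ : X' ⟶ X₂) (x' : X'),
          Etale e₁ ∧ Etale e₂ ∧ e₁.base x' = x₁ ∧ e₂.base x' = x₂ ∧ e₁ ≫ f₁ = e₂ ≫ f₂ ∧
            Function.Surjective (e₁.residueFieldMap x') ∧
              Function.Surjective (e₂.residueFieldMap x'))
    (hFT : ∀ (k : Type) [Field k] (A : Type) [AddCommGroup A] [Finite A] [DecidableEq A]
      (S : Type) [CommRing S] [Algebra k S] (𝒮 : A → Submodule k S) [GradedAlgebra 𝒮]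
      [Algebra.FiniteType k S], Algebra.FiniteType k (𝒮 0))
    (hBC : ∀ (k : Type) [Field k] (A : Type) [AddCommGroup A] [Finite A] [DecidableEq A]
      (S : Type) [CommRing S] [Algebra k S] (𝒮 : A → Submodule k S) [GradedAlgebra 𝒮]
      [Algebra.FiniteType k S] [Algebra.Smooth k S] [Algebra.FiniteType k (𝒮 0)]
      (R : Type) [CommRing R] [Algebra k R] [Algebra (𝒮 0) R] [IsScalarTower k (𝒮 0) R]
      [Algebra.Etale (𝒮 0) R],
      ∃ (S' : Type) (_ : CommRing S') (_ : Algebra k S') (𝒮' : A → Submodule k S')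
        (_ : GradedAlgebra 𝒮'), Algebra.FiniteType k S' ∧ Algebra.Smooth k S' ∧
        Nonempty ((𝒮' 0) ≃ₐ[k] R))
    {k : Type} [Field k] (X : Scheme.{0}) (g : X ⟶ Spec (.of k)) [LocallyOfFiniteType g]
    [QuasiCompact g] (x : X)
    (A : Type) [AddCommGroup A] [Finite A] [DecidableEq A] (S : Type) [CommRing S] [Algebra k S]
    (𝒮 : A → Submodule k S) [GradedAlgebra 𝒮] [Algebra.FiniteType k S] [Algebra.Smooth k S]
    (t : Spec (.of (𝒮 0)))
    (e : AdicCompletion (maximalIdeal (X.presheaf.stalk x)) (X.presheaf.stalk x) ≃+*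
      AdicCompletion (maximalIdeal ((Spec (.of (𝒮 0))).presheaf.stalk t))
        ((Spec (.of (𝒮 0))).presheaf.stalk t))
    (he : ∀ a : k,
      e (algebraMap _ _ ((X.presheaf.germ ⊤ x trivial).hom
          (g.appTop.hom ((Scheme.ΓSpecIso (.of k)).inv.hom a)))) =
        algebraMap _ _ (((Spec (.of (𝒮 0))).presheaf.germ ⊤ t trivial).hom
          ((Spec.map (CommRingCat.ofHom (algebraMap k (𝒮 0)))).appTop.hom
            ((Scheme.ΓSpecIso (.of k)).inv.hom a)))) :
    ∃ (A' : Type) (_ : AddCommGroup A') (_ : Finite A') (_ : DecidableEq A')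
      (S' : Type) (_ : CommRing S') (_ : Algebra k S') (𝒮' : A' → Submodule k S')
      (_ : GradedAlgebra 𝒮'), Algebra.FiniteType k S' ∧ Algebra.Smooth k S' ∧
      ∃ φ : Spec (.of (𝒮' 0)) ⟶ X, Etale φ ∧ x ∈ Set.range φ ∧
        φ ≫ g = Spec.map (CommRingCat.ofHom (algebraMap k (𝒮' 0))) := by
  -- (1) the formal model `T = Spec S₀` as a `k`-scheme of finite type
  haveI hS0 : Algebra.FiniteType k (𝒮 0) := hFT k A S 𝒮
  have hqc : QuasiCompact (Spec.map (CommRingCat.ofHom (algebraMap k (𝒮 0)))) := inferInstance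
  have hft : LocallyOfFiniteType (Spec.map (CommRingCat.ofHom (algebraMap k (𝒮 0)))) := by
    rw [HasRingHomProperty.Spec_iff (P := @LocallyOfFiniteType), CommRingCat.hom_ofHom]
    exact RingHom.finiteType_algebraMap.mpr hS0
  -- (2) Artin: a common étale neighbourhood
  obtain ⟨X'', e₁, e₂, x'', _, _, hx₁, -, hcomm, -, -⟩ :=
    hA k X (Spec (.of (𝒮 0))) g (Spec.map (CommRingCat.ofHom (algebraMap k (𝒮 0)))) ‹_› ‹_›
      hft hqc x t e he
  -- (3) an affine open neighbourhood of `x''`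
  obtain ⟨_, ⟨U, hU, rfl⟩, hxU, -⟩ :=
    X''.isBasis_affineOpens.exists_subset_of_mem_open (Set.mem_univ x'') isOpen_univ
  -- (4) the structure map `σ : S₀ → Γ(X'', U)` of the étale composite `Spec Γ(X'', U) → T`
  obtain ⟨σ', hσ'⟩ := Spec.map_surjective (hU.fromSpec ≫ e₂)
  -- (5) `Γ(X'', U)` is an étale `S₀`-algebra
  have hEt : Etale (Spec.map σ') := by rw [hσ']; infer_instance
  have hσet : σ'.hom.Etale := (HasRingHomProperty.Spec_iff (P := @Etale)).mp hEt
  letI : Algebra (𝒮 0) Γ(X'', U) := σ'.hom.toAlgebra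
  letI : Algebra k Γ(X'', U) := (σ'.hom.comp (algebraMap k (𝒮 0))).toAlgebra
  haveI : IsScalarTower k (𝒮 0) Γ(X'', U) := IsScalarTower.of_algebraMap_eq (fun _ => rfl)
  haveI : Algebra.Etale (𝒮 0) Γ(X'', U) := hσet
  -- (6) graded étale base change
  obtain ⟨S', iS₁, iS₂, 𝒮', iS₃, hft', hsm', ⟨ψ⟩⟩ := hBC k A S 𝒮 Γ(X'', U)
  -- (7) the chart
  let ι : Spec (.of (𝒮' 0)) ⟶ Spec Γ(X'', U) :=
    Spec.map ψ.symm.toRingEquiv.toCommRingCatIso.hom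
  haveI : IsIso ι := inferInstance
  refine ⟨A, inferInstance, inferInstance, inferInstance, S', iS₁, iS₂, 𝒮', iS₃, hft', hsm',
    ι ≫ hU.fromSpec ≫ e₁, inferInstance, ?_, ?_⟩
  · -- (8) `x` lies in the image
    have hxU' : x'' ∈ Set.range hU.fromSpec := by rw [hU.range_fromSpec]; exact hxU
    obtain ⟨p, hp⟩ := hxU'
    obtain ⟨q, hq⟩ := ι.homeomorph.surjective p
    refine ⟨q, ?_⟩
    rw [Scheme.Hom.homeomorph_apply] at hq
    rw [Scheme.Hom.comp_apply, Scheme.Hom.comp_apply, hq, hp]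
    exact hx₁
  · -- (9) the chart is a `k`-morphism
    rw [Category.assoc, Category.assoc, hcomm, ← Category.assoc hU.fromSpec, ← hσ',
      ← Spec.map_comp, ← Spec.map_comp]
    congr 1
    refine CommRingCat.hom_ext (RingHom.ext fun a => ?_)
    change ψ.symm (algebraMap k Γ(X'', U) a) = algebraMap k (𝒮' 0) a
    exact ψ.symm.commutes a

end Summit.ResolutionOfSingularities.ResolutionOfSingularities.Theorems.TeissierResolve.ChartAssembly

end
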